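import Summits.ValiantsHypothesis.ValiantsHypothesis.Theorems.GrenetZeonDualUnipotentThreeHalvesHeavyTopNilIndexCodimOne
import Summits.ValiantsHypothesis.ValiantsHypothesis.Theorems.GrenetZeonDualUnipotentThreeHalvesHeavyTopNilIndexCodimTwoPaths

/-!
# `GrenetZeon.DualUnipotentThreeHalves` (stmt-ValiantsHypothesis-24318), R2 heavy-top instrument — LEMMA T2 (d = 2) IN THE KERNEL:
# a codimension-two subspace of `𝔫_m` of nilindex `≤ m − 2` is a coordinate pattern `𝔫_m ∖ {E_{a,a+1}, E_{b,b+1}}` with `b ≥ a + 2`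

Experiment cell «val-heavytop-census» (D-0160), engine seat val-htc-eng-2 g6 (MAINTENANCE idle-slot chore, kit 0).  Kernel port of lead
CENSUS-EXTREMISERS X16 LEMMA T2 = the TRIANGULARISABLE half of PREREG Q22's conjecture C2 («dim V = C(m,2) − 2 ∧ A^{m−2} ≡ 0 on V ⇒ V is conjugate
to 𝔫_m minus two non-adjacent superdiagonal units»): here `V` is assumed (conjugate) inside `𝔫_m`.  Second of two files (calculus: `…CodimTwoPaths`).

**Theorem** (`strictUpper_codimTwo_of_pow_eq_zero`; size `k + 1 = L + 2`).  Let `U ≤ 𝔫_{k+1}` with `dim U = C(k+1,2) − 2` and `A ^ (k−1) = 0` for all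
`A ∈ U`.  Then `U = H_a ⊓ H_b := {A ∈ 𝔫 : A_{a,a+1} = A_{b,b+1} = 0}` for superdiagonal indices `a + 2 ≤ b` (membership as an `↔`).  Conversely such
patterns DO have dimension `C(k+1,2) − 2` and nilindex `≤ k − 1` (not re-proved here); the conjugation-invariant wrapper is
`codimTwo_pattern_of_triangularisable`.  For `k ≤ 2` the hypotheses are contradictory (vacuous statement).

Proof.  `(A^{k−1})_{0,k−1} = ∏_{t ≤ k−2} x_t` and `(A^{k−1})_{1,k} = ∏_{t ≥ 1} x_t` vanish on `U` (`x_t = A_{t,t+1}`); since finitely many linear forms each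
non-zero somewhere on `U` have a common good vector (`exists_mem_forall_apply_ne_zero`), some `x_a` (`a ≤ k−2`) and some `x_b` (`b ≥ 1`) vanish identically
on `U`.  If two distinct coordinates vanish, `U = H_a ⊓ H_b` by dimension, and adjacency `b = a + 1` is excluded by the skip-chain witness
`W(a+1, 0) ∈ H_a ⊓ H_{a+1}` with `W^{k−1} ≠ 0` (✓ `skipChain_pow_ne_zero`).  If only `x_a` vanishes (`1 ≤ a ≤ k−2`), `U` is a hyperplane of `H_a`, so some
`D = αE_{a−1,a+1} + βE_{a,a+2} ≠ 0` lies in `U`; the first-order identity (✓ `pow_apply_long_perturb`) applied to `A, A + D ∈ U` gives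
`∏_{t ∉ {a−1,a,a+1}} x_t · (β x_{a−1} + α x_{a+1}) ≡ 0` on `U`, hence (good vector again) `β x_{a−1} + α x_{a+1} ≡ 0` on `U`; `α = 0` or `β = 0` would make a
second coordinate vanish, and otherwise `U = H_a ⊓ ker(β x_{a−1} + α x_{a+1})` contains the witness `W(a, −α/β)` with `W^{k−1} ≠ 0` — contradiction.

* `exists_mem_forall_apply_ne_zero` — the good-vector lemma for a finite family of linear forms on a subspace (`ℂ` infinite);
* `exists_smul_add_smul_mem_of_corank_le_one` — a subspace of corank `≤ 1` in `H` contains a non-trivial combination of any two vectors of `H`;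
* `eq_of_forall_superdiag_two` — two distinct vanishing coordinates pin `U` down and are non-adjacent;
* ★ `strictUpper_codimTwo_of_pow_eq_zero` — the theorem; `codimTwo_pattern_of_triangularisable` — the conjugation-invariant form.

Context (lead g6, 15:41Z): with this file the kernel holds the whole TRIANGULARISABLE half of C2; by EXTREMISERS X17 the remaining half of C2(m) is
the irreducibility statement (I_s), s ≤ m («no irreducible nilpotent subspace of M_s of dimension C(s,2) − 2 with A^{s−2} ≡ 0»), open for s ≥ 7.
The converse of the theorem (the patterns with `a + 2 ≤ b` do have nilindex `≤ L` and codimension two) is `…HeavyTopNilIndexCodimTwoSharp`.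

Honest framing: enemy-side structure for the census instrument (EXTREMISERS X16; PREREG Q22 pattern half); 0 GRID cells; nothing here proves or refutes
`HeavyTopLaw`, 24318, S3b or 8062; `VP ≠ VNP` is NOT proved.  No definitions, no named facts.  [folklore linear algebra; lead CENSUS-EXTREMISERS X16 LEMMA T2; this cell]
-/

noncomputable section

-- single-conjunct layout: Sub = Summit, duplicated namespace component intended
set_option linter.dupNamespace false

namespace Summit.ValiantsHypothesis.ValiantsHypothesis.Theorems.GrenetZeon.HeavyTopNilIndexCodimTwo

open Matrix
open Literature.LinearAlgebra.Matrix (IsStrictUpper)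
open Literature.LinearAlgebra.Matrix.GerstenhaberNilpotentSubspace (nt mem_nt_iff_isStrictUpper finrank_nt conjEquiv)
open Summit.ValiantsHypothesis.ValiantsHypothesis.Theorems.GrenetZeon.HeavyTopNilIndexCodimOne (mem_nt_inf_ker_entry nt_inf_ker_entry_lt_nt
  finrank_nt_inf_ker_entry)
open Summit.ValiantsHypothesis.ValiantsHypothesis.Theorems.GrenetZeon.HeavyTopNilIndexCodimTwoPaths (pow_apply_eq_prod_offset
  pow_apply_long_perturb skipChain_isStrictUpper skipChain_superdiag_of_ne skipChain_superdiag_pred skipChain_superdiag_self skipChain_pow_ne_zero)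
open Summit.ValiantsHypothesis.ValiantsHypothesis.Theorems.GrenetZeon.HeavyTopNilIndexTower (conj_pow)

/-! ## Good vectors for a finite family of linear forms -/

/-- If each linear form `f i` (`i ∈ s`, `s` finite) is non-zero somewhere on the subspace `U`, some `u ∈ U` has `f i u ≠ 0` for all `i ∈ s`
(a line `u + c v` meets each hyperplane `ker f i` in at most one `c`; `ℂ` is infinite). [folklore] -/
theorem exists_mem_forall_apply_ne_zero {M : Type*} [AddCommGroup M] [Module ℂ M] (U : Submodule ℂ M) {ι : Type*} (s : Finset ι)
    (f : ι → M →ₗ[ℂ] ℂ) (h : ∀ i ∈ s, ∃ u ∈ U, f i u ≠ 0) : ∃ u ∈ U, ∀ i ∈ s, f i u ≠ 0 := by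
  classical
  induction s using Finset.induction_on with
  | empty => exact ⟨0, U.zero_mem, by simp⟩
  | insert a s ha ih =>
    obtain ⟨u, hu, hus⟩ := ih fun i hi => h i (Finset.mem_insert_of_mem hi)
    obtain ⟨v, hv, hva⟩ := h a (Finset.mem_insert_self a s)
    obtain ⟨c, hc⟩ := Infinite.exists_notMem_finset ((insert a s).image fun i => -f i u / f i v)
    refine ⟨u + c • v, U.add_mem hu (U.smul_mem c hv), fun i hi h0 => ?_⟩
    rw [map_add, map_smul, smul_eq_mul] at h0
    by_cases hfi : f i v = 0
    · rw [hfi, mul_zero, add_zero] at h0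
      rcases Finset.mem_insert.1 hi with rfl | hi'
      · exact hva hfi
      · exact hus i hi' h0
    · exact hc (Finset.mem_image.2 ⟨i, hi, by rw [eq_comm, eq_div_iff hfi]; linear_combination h0⟩)

/-- A subspace `U ≤ H` with `dim H ≤ dim U + 1` contains a non-trivial combination `α D₁ + β D₂` of any two `D₁, D₂ ∈ H`. [folklore] -/
theorem exists_smul_add_smul_mem_of_corank_le_one {M : Type*} [AddCommGroup M] [Module ℂ M] [FiniteDimensional ℂ M] {U H : Submodule ℂ M}
    (hUH : U ≤ H) (hdim : Module.finrank ℂ H ≤ Module.finrank ℂ U + 1) {D₁ D₂ : M} (hD₁ : D₁ ∈ H) (hD₂ : D₂ ∈ H) :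
    ∃ α β : ℂ, (α ≠ 0 ∨ β ≠ 0) ∧ α • D₁ + β • D₂ ∈ U := by
  classical
  by_cases h1 : D₁ ∈ U
  · exact ⟨1, 0, Or.inl one_ne_zero, by rw [one_smul, zero_smul, add_zero]; exact h1⟩
  -- `U ⊔ ℂ D₁ = H`
  have hlt : U < U ⊔ Submodule.span ℂ {D₁} :=
    lt_of_le_of_ne le_sup_left fun hEq => h1 (by rw [hEq]; exact Submodule.mem_sup_right (Submodule.mem_span_singleton_self D₁))
  have hle : U ⊔ Submodule.span ℂ {D₁} ≤ H := sup_le hUH ((Submodule.span_singleton_le_iff_mem _ _).2 hD₁)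
  have hEq : U ⊔ Submodule.span ℂ {D₁} = H :=
    Submodule.eq_of_le_of_finrank_le hle (by have := Submodule.finrank_lt_finrank_of_lt hlt; omega)
  have hD₂' : D₂ ∈ U ⊔ Submodule.span ℂ {D₁} := by rw [hEq]; exact hD₂
  obtain ⟨u, hu, z, hz, huz⟩ := Submodule.mem_sup.1 hD₂'
  obtain ⟨γ, rfl⟩ := Submodule.mem_span_singleton.1 hz
  refine ⟨-γ, 1, Or.inr one_ne_zero, ?_⟩
  have : -γ • D₁ + (1 : ℂ) • D₂ = u := by rw [← huz]; module
  rw [this]; exact hu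

/-! ## Two vanishing superdiagonal coordinates -/

section Main

variable {L : ℕ} (U : Submodule ℂ (Matrix (Fin (L + 1 + 1)) (Fin (L + 1 + 1)) ℂ)) (hU : ∀ A ∈ U, IsStrictUpper A)
  (hdim : Module.finrank ℂ U = (L + 1 + 1).choose 2 - 2) (hpow : ∀ A ∈ U, A ^ L = 0)

include hU hdim hpow in
/-- If two DISTINCT superdiagonal coordinates `x_a, x_b` vanish on `U` (`U ≤ 𝔫`, `dim U = C − 2`, nilindex `≤ L`), then `U = H_a ⊓ H_b` and `a, b` are
not adjacent. [this file] -/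
theorem eq_of_forall_superdiag_two (a b : Fin (L + 1)) (hab : (a : ℕ) < b) (ha : ∀ A ∈ U, A a.castSucc a.succ = 0)
    (hb : ∀ A ∈ U, A b.castSucc b.succ = 0) :
    (a : ℕ) + 2 ≤ b ∧ ∀ A, A ∈ U ↔ IsStrictUpper A ∧ A a.castSucc a.succ = 0 ∧ A b.castSucc b.succ = 0 := by
  classical
  -- `U = H_a ⊓ ker x_b` by dimension
  set K : Submodule ℂ (Matrix (Fin (L + 1 + 1)) (Fin (L + 1 + 1)) ℂ) :=
    (nt ℂ (L + 1 + 1) ⊓ LinearMap.ker (Matrix.entryLinearMap ℂ ℂ (Fin.castSucc a) (Fin.succ a))) ⊓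
      LinearMap.ker (Matrix.entryLinearMap ℂ ℂ (Fin.castSucc b) (Fin.succ b)) with hK
  have hmemK : ∀ A, A ∈ K ↔ IsStrictUpper A ∧ A a.castSucc a.succ = 0 ∧ A b.castSucc b.succ = 0 := fun A => by
    rw [hK, Submodule.mem_inf, mem_nt_inf_ker_entry, LinearMap.mem_ker, Matrix.entryLinearMap_apply, and_assoc]
  have hUK : U ≤ K := fun A hA => (hmemK A).2 ⟨hU A hA, ha A hA, hb A hA⟩
  have hKlt : K < nt ℂ (L + 1 + 1) ⊓ LinearMap.ker (Matrix.entryLinearMap ℂ ℂ (Fin.castSucc a) (Fin.succ a)) := by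
    refine lt_of_le_of_ne inf_le_left fun hEq => ?_
    -- `E_{b,b+1} ∈ H_a \\ K`
    have hE : Matrix.single (Fin.castSucc b) (Fin.succ b) (1 : ℂ) ∈
        nt ℂ (L + 1 + 1) ⊓ LinearMap.ker (Matrix.entryLinearMap ℂ ℂ (Fin.castSucc a) (Fin.succ a)) := by
      rw [mem_nt_inf_ker_entry]
      refine ⟨fun i j hij => ?_, ?_⟩
      · rw [Matrix.single_apply, if_neg]
        rintro ⟨rfl, rfl⟩
        exact absurd hij (not_le.2 (Fin.castSucc_lt_succ (i := b)))
      · rw [Matrix.single_apply, if_neg]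
        rintro ⟨h1, -⟩
        have := congrArg Fin.val h1
        simp at this; omega
    rw [← hEq, hmemK] at hE
    simpa using hE.2.2
  have hKdim : Module.finrank ℂ K ≤ Module.finrank ℂ U := by
    have h1 := Submodule.finrank_lt_finrank_of_lt hKlt
    rw [finrank_nt_inf_ker_entry] at h1
    omega
  have hUeq : U = K := Submodule.eq_of_le_of_finrank_le hUK hKdim
  refine ⟨?_, fun A => by rw [hUeq, hmemK]⟩
  -- adjacency is excluded by the skip-chain witness `W(b, 0)`
  by_contra hlt
  have hb1 : (b : ℕ) = a + 1 := by omega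
  set W : Matrix (Fin (L + 1 + 1)) (Fin (L + 1 + 1)) ℂ := Matrix.of fun r s : Fin (L + 1 + 1) =>
      if (s : ℕ) = r + 1 ∧ (r : ℕ) + 1 ≠ (b : ℕ) ∧ (r : ℕ) ≠ (b : ℕ) then (1 : ℂ)
      else if (r : ℕ) + 1 = (b : ℕ) ∧ (s : ℕ) = (b : ℕ) + 1 then 1
      else if (r : ℕ) + 1 = (b : ℕ) ∧ (s : ℕ) = (b : ℕ) then (0 : ℂ) else 0 with hW
  have hWU : W ∈ U := by
    rw [hUeq, hmemK]
    exact ⟨skipChain_isStrictUpper L b 0, skipChain_superdiag_pred L b 0 a (by omega), skipChain_superdiag_self L b 0 b rfl⟩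
  exact skipChain_pow_ne_zero L b 0 (hpow W hWU)

include hU hdim hpow in
/-- ★ **LEMMA T2 (d = 2) in the kernel.**  `U ≤ 𝔫_{L+2}`, `dim U = C(L+2, 2) − 2`, `A ^ L = 0` for all `A ∈ U` ⇒ `U = H_a ⊓ H_b` with `a + 2 ≤ b`:
`U` IS the coordinate pattern `𝔫 ∖ {E_{a,a+1}, E_{b,b+1}}` with NON-ADJACENT missing units (for `L ≤ 1` the hypotheses are contradictory and the
statement is vacuous; the content starts at `4 × 4`).  [lead CENSUS-EXTREMISERS X16 LEMMA T2; this file] -/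
theorem strictUpper_codimTwo_of_pow_eq_zero :
    ∃ a b : Fin (L + 1), (a : ℕ) + 2 ≤ b ∧ ∀ A, A ∈ U ↔ IsStrictUpper A ∧ A a.castSucc a.succ = 0 ∧ A b.castSucc b.succ = 0 := by
  classical
  -- the superdiagonal coordinates as linear forms
  set x : Fin (L + 1) → Matrix (Fin (L + 1 + 1)) (Fin (L + 1 + 1)) ℂ →ₗ[ℂ] ℂ :=
    fun t => Matrix.entryLinearMap ℂ ℂ (Fin.castSucc t) (Fin.succ t) with hx
  have hxap : ∀ t A, x t A = A t.castSucc t.succ := fun t A => rfl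
  -- (1) a vanishing coordinate among `t ≤ L − 1`, from `(A^L)_{0,L} = ∏_{t<L} x_t`
  obtain ⟨a, haL, ha⟩ : ∃ a : Fin (L + 1), (a : ℕ) + 1 ≤ L ∧ ∀ A ∈ U, A a.castSucc a.succ = 0 := by
    by_contra hne
    push Not at hne
    obtain ⟨A, hA, hAx⟩ := exists_mem_forall_apply_ne_zero U (Finset.univ.filter fun t : Fin (L + 1) => (t : ℕ) + 1 ≤ L) x
      fun t ht => by
        obtain ⟨B, hB, hBt⟩ := hne t (Finset.mem_filter.1 ht).2
        exact ⟨B, hB, by rw [hxap]; exact hBt⟩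
    have hP := pow_apply_eq_prod_offset A (hU A hA) 0 L (by omega)
    rw [hpow A hA, Matrix.zero_apply] at hP
    refine absurd hP.symm (Finset.prod_ne_zero_iff.2 fun t _ => ?_)
    have := hAx ⟨t, by omega⟩ (Finset.mem_filter.2 ⟨Finset.mem_univ _, by simp⟩)
    rw [hxap] at this
    have e1 : (Fin.castSucc (⟨t, by omega⟩ : Fin (L + 1)) : Fin (L + 1 + 1)) = ⟨0 + t, by omega⟩ := Fin.ext (by simp)
    have e2 : (Fin.succ (⟨t, by omega⟩ : Fin (L + 1)) : Fin (L + 1 + 1)) = ⟨0 + t + 1, by omega⟩ := Fin.ext (by simp)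
    rwa [e1, e2] at this
  -- (2) a vanishing coordinate among `t ≥ 1`, from `(A^L)_{1,L+1} = ∏_{t<L} x_{1+t}`
  obtain ⟨b, hb1, hb⟩ : ∃ b : Fin (L + 1), 1 ≤ (b : ℕ) ∧ ∀ A ∈ U, A b.castSucc b.succ = 0 := by
    by_contra hne
    push Not at hne
    obtain ⟨A, hA, hAx⟩ := exists_mem_forall_apply_ne_zero U (Finset.univ.filter fun t : Fin (L + 1) => 1 ≤ (t : ℕ)) x
      fun t ht => by
        obtain ⟨B, hB, hBt⟩ := hne t (Finset.mem_filter.1 ht).2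
        exact ⟨B, hB, by rw [hxap]; exact hBt⟩
    have hP := pow_apply_eq_prod_offset A (hU A hA) 1 L (by omega)
    rw [hpow A hA, Matrix.zero_apply] at hP
    refine absurd hP.symm (Finset.prod_ne_zero_iff.2 fun t _ => ?_)
    have := hAx ⟨1 + t, by omega⟩ (Finset.mem_filter.2 ⟨Finset.mem_univ _, by simp⟩)
    rw [hxap] at this
    have e1 : (Fin.castSucc (⟨1 + t, by omega⟩ : Fin (L + 1)) : Fin (L + 1 + 1)) = ⟨1 + t, by omega⟩ := Fin.ext (by simp)
    have e2 : (Fin.succ (⟨1 + t, by omega⟩ : Fin (L + 1)) : Fin (L + 1 + 1)) = ⟨1 + t + 1, by omega⟩ := Fin.ext (by simp)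
    rwa [e1, e2] at this
  -- (3) two distinct vanishing coordinates finish the proof
  have two : ∀ a' b' : Fin (L + 1), (a' : ℕ) < b' → (∀ A ∈ U, A a'.castSucc a'.succ = 0) → (∀ A ∈ U, A b'.castSucc b'.succ = 0) →
      ∃ a b : Fin (L + 1), (a : ℕ) + 2 ≤ b ∧ ∀ A, A ∈ U ↔ IsStrictUpper A ∧ A a.castSucc a.succ = 0 ∧ A b.castSucc b.succ = 0 :=
    fun a' b' h ha' hb' => ⟨a', b', eq_of_forall_superdiag_two U hU hdim hpow a' b' h ha' hb'⟩
  by_cases hab : (a : ℕ) = b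
  swap
  · rcases Nat.lt_or_gt_of_ne hab with h | h
    · exact two a b h ha hb
    · exact two b a h hb ha
  -- (4) ONE vanishing coordinate `x_a`, `1 ≤ a ≤ L − 1`; any other vanishing coordinate finishes
  by_cases hother : ∃ t : Fin (L + 1), (t : ℕ) ≠ a ∧ ∀ A ∈ U, A t.castSucc t.succ = 0
  · obtain ⟨t, hta, ht⟩ := hother
    rcases Nat.lt_or_gt_of_ne hta with h | h
    · exact two t a h ht ha
    · exact two a t h ha ht
  push Not at hother
  exfalso
  -- coordinates: `a = c + 1`, `L + 1 = c + d + 3`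
  obtain ⟨c, hc⟩ : ∃ c : ℕ, (a : ℕ) = c + 1 := ⟨(a : ℕ) - 1, by omega⟩
  obtain ⟨d, hd⟩ : ∃ d : ℕ, c + d + 3 = L + 1 := ⟨L - 2 - c, by omega⟩
  -- `U` is a hyperplane of `H_a`: a non-trivial `D = α E_{c,c+2} + β E_{c+1,c+3}` lies in `U`
  have hUH : U ≤ nt ℂ (L + 1 + 1) ⊓ LinearMap.ker (Matrix.entryLinearMap ℂ ℂ (Fin.castSucc a) (Fin.succ a)) :=
    fun A hA => (mem_nt_inf_ker_entry a A).2 ⟨hU A hA, ha A hA⟩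
  set D₁ : Matrix (Fin (L + 1 + 1)) (Fin (L + 1 + 1)) ℂ :=
    Matrix.of fun r s => if (r : ℕ) = c ∧ (s : ℕ) = c + 2 then (1 : ℂ) else 0 with hD₁
  set D₂ : Matrix (Fin (L + 1 + 1)) (Fin (L + 1 + 1)) ℂ :=
    Matrix.of fun r s => if (r : ℕ) = c + 1 ∧ (s : ℕ) = c + 3 then (1 : ℂ) else 0 with hD₂
  have hD₁H : D₁ ∈ nt ℂ (L + 1 + 1) ⊓ LinearMap.ker (Matrix.entryLinearMap ℂ ℂ (Fin.castSucc a) (Fin.succ a)) := by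
    rw [mem_nt_inf_ker_entry]
    refine ⟨fun i j hij => ?_, ?_⟩
    · have hij' : (j : ℕ) ≤ i := hij
      rw [hD₁, Matrix.of_apply, if_neg (by omega)]
    · rw [hD₁, Matrix.of_apply, if_neg (by simp; omega)]
  have hD₂H : D₂ ∈ nt ℂ (L + 1 + 1) ⊓ LinearMap.ker (Matrix.entryLinearMap ℂ ℂ (Fin.castSucc a) (Fin.succ a)) := by
    rw [mem_nt_inf_ker_entry]
    refine ⟨fun i j hij => ?_, ?_⟩
    · have hij' : (j : ℕ) ≤ i := hij
      rw [hD₂, Matrix.of_apply, if_neg (by omega)]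
    · rw [hD₂, Matrix.of_apply, if_neg (by simp; omega)]
  obtain ⟨α, β, hαβ, hDU⟩ := exists_smul_add_smul_mem_of_corank_le_one hUH
    (by rw [finrank_nt_inf_ker_entry, hdim]; omega) hD₁H hD₂H
  set D := α • D₁ + β • D₂ with hD
  have hDap : ∀ r s : Fin (L + 1 + 1), D r s =
      (if (r : ℕ) = c ∧ (s : ℕ) = c + 2 then α else 0) + (if (r : ℕ) = c + 1 ∧ (s : ℕ) = c + 3 then β else 0) := fun r s => by
    rw [hD, Matrix.add_apply, Matrix.smul_apply, Matrix.smul_apply, hD₁, hD₂, Matrix.of_apply, Matrix.of_apply, smul_eq_mul, smul_eq_mul,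
      mul_ite, mul_ite, mul_one, mul_zero, mul_one, mul_zero]
  have hDsu : IsStrictUpper D := fun i j hij => by
    have hij' : (j : ℕ) ≤ i := hij
    rw [hDap, if_neg (by omega), if_neg (by omega), add_zero]
  -- the linear form `ℓ = β x_c + α x_{c+2}` vanishes on `U` times the outer products; first: it vanishes identically on `U`
  set ℓ : Matrix (Fin (L + 1 + 1)) (Fin (L + 1 + 1)) ℂ →ₗ[ℂ] ℂ :=
    β • Matrix.entryLinearMap ℂ ℂ (⟨c, by omega⟩ : Fin (L + 1 + 1)) ⟨c + 1, by omega⟩ +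
      α • Matrix.entryLinearMap ℂ ℂ (⟨c + 2, by omega⟩ : Fin (L + 1 + 1)) ⟨c + 3, by omega⟩ with hℓ
  have hℓap : ∀ A : Matrix (Fin (L + 1 + 1)) (Fin (L + 1 + 1)) ℂ,
      ℓ A = β * A ⟨c, by omega⟩ ⟨c + 1, by omega⟩ + α * A ⟨c + 2, by omega⟩ ⟨c + 3, by omega⟩ := fun A => by
    simp only [hℓ, LinearMap.add_apply, LinearMap.smul_apply, Matrix.entryLinearMap_apply, smul_eq_mul]
  have key : ∀ A ∈ U, (∏ t : Fin c, A ⟨t, by omega⟩ ⟨t + 1, by omega⟩) * ℓ A *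
      ∏ t : Fin d, A ⟨c + 3 + t, by omega⟩ ⟨c + 3 + t + 1, by omega⟩ = 0 := fun A hA => by
    have h := pow_apply_long_perturb A D (hU A hA) hDsu c α β
      (fun t ht => by rw [hDap, if_neg (by dsimp only; omega), if_neg (by dsimp only; omega), add_zero])
      (fun i hi h1 h2 => by rw [hDap, if_neg (by dsimp only; omega), if_neg (by dsimp only; omega), add_zero]) d (by omega)
      (by rw [hDap, if_pos ⟨rfl, rfl⟩, if_neg (by dsimp only; omega), add_zero])
      (by rw [hDap, if_neg (by dsimp only; omega), if_pos ⟨rfl, rfl⟩, zero_add])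
    have hAD : A + D ∈ U := U.add_mem hA hDU
    rw [show c + d + 2 = L by omega, hpow _ hAD, hpow A hA, Matrix.zero_apply, zero_add] at h
    rw [hℓap]; exact h.symm
  have hℓU : ∀ A ∈ U, ℓ A = 0 := by
    by_contra hne
    push Not at hne
    obtain ⟨A₀, hA₀, hA₀ℓ⟩ := hne
    -- a good vector: all `x_t ≠ 0` (`t ∉ {c, c+1, c+2}`) and `ℓ ≠ 0`
    obtain ⟨A, hA, hAx⟩ := exists_mem_forall_apply_ne_zero U
      (insert none ((Finset.univ.filter fun t : Fin (L + 1) => (t : ℕ) ≠ c ∧ (t : ℕ) ≠ c + 1 ∧ (t : ℕ) ≠ c + 2).image some))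
      (fun o : Option (Fin (L + 1)) => o.elim ℓ x) (by
        intro o ho
        rcases Finset.mem_insert.1 ho with rfl | ho'
        · exact ⟨A₀, hA₀, hA₀ℓ⟩
        · obtain ⟨t, ht, rfl⟩ := Finset.mem_image.1 ho'
          have ht' := (Finset.mem_filter.1 ht).2
          obtain ⟨B, hB, hBt⟩ := hother t (by omega)
          exact ⟨B, hB, by simp only [Option.elim, hxap]; exact hBt⟩)
    have hxA : ∀ t : Fin (L + 1), (t : ℕ) ≠ c → (t : ℕ) ≠ c + 1 → (t : ℕ) ≠ c + 2 → A t.castSucc t.succ ≠ 0 := fun t h1 h2 h3 => by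
      have := hAx (some t) (Finset.mem_insert_of_mem (Finset.mem_image.2 ⟨t, Finset.mem_filter.2 ⟨Finset.mem_univ _, h1, h2, h3⟩, rfl⟩))
      simpa only [Option.elim, hxap] using this
    have hℓA : ℓ A ≠ 0 := by simpa only [Option.elim] using hAx none (Finset.mem_insert_self _ _)
    refine hℓA ?_
    have hk := key A hA
    have hP1 : ∏ t : Fin c, A ⟨t, by omega⟩ ⟨t + 1, by omega⟩ ≠ 0 := Finset.prod_ne_zero_iff.2 fun t _ => by
      have := hxA ⟨t, by omega⟩ (by simp; omega) (by simp; omega) (by simp; omega)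
      have e1 : (Fin.castSucc (⟨t, by omega⟩ : Fin (L + 1)) : Fin (L + 1 + 1)) = ⟨t, by omega⟩ := Fin.ext (by simp)
      have e2 : (Fin.succ (⟨t, by omega⟩ : Fin (L + 1)) : Fin (L + 1 + 1)) = ⟨t + 1, by omega⟩ := Fin.ext (by simp)
      rwa [e1, e2] at this
    have hP2 : ∏ t : Fin d, A ⟨c + 3 + t, by omega⟩ ⟨c + 3 + t + 1, by omega⟩ ≠ 0 := Finset.prod_ne_zero_iff.2 fun t _ => by
      have := hxA ⟨c + 3 + t, by omega⟩ (by simp; omega) (by simp; omega) (by simp; omega)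
      have e1 : (Fin.castSucc (⟨c + 3 + t, by omega⟩ : Fin (L + 1)) : Fin (L + 1 + 1)) = ⟨c + 3 + t, by omega⟩ := Fin.ext (by simp)
      have e2 : (Fin.succ (⟨c + 3 + t, by omega⟩ : Fin (L + 1)) : Fin (L + 1 + 1)) = ⟨c + 3 + t + 1, by omega⟩ := Fin.ext (by simp)
      rwa [e1, e2] at this
    rcases mul_eq_zero.1 hk with h | h
    · rcases mul_eq_zero.1 h with h' | h'
      · exact absurd h' hP1
      · exact h'
    · exact absurd h hP2
  -- `α = 0` or `β = 0` would make a second coordinate vanish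
  have hβ : β ≠ 0 := by
    intro hβ0
    have hα : α ≠ 0 := hαβ.resolve_right (fun h => h hβ0)
    obtain ⟨B, hB, hBt⟩ := hother ⟨c + 2, by omega⟩ (by simp; omega)
    have := hℓU B hB
    rw [hℓap, hβ0, zero_mul, zero_add] at this
    refine hBt ?_
    have e1 : (Fin.castSucc (⟨c + 2, by omega⟩ : Fin (L + 1)) : Fin (L + 1 + 1)) = ⟨c + 2, by omega⟩ := Fin.ext (by simp)
    have e2 : (Fin.succ (⟨c + 2, by omega⟩ : Fin (L + 1)) : Fin (L + 1 + 1)) = ⟨c + 3, by omega⟩ := Fin.ext (by simp)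
    rw [e1, e2]
    exact (mul_eq_zero.1 this).resolve_left hα
  have hα : α ≠ 0 := by
    intro hα0
    obtain ⟨B, hB, hBt⟩ := hother ⟨c, by omega⟩ (by simp; omega)
    have := hℓU B hB
    rw [hℓap, hα0, zero_mul, add_zero] at this
    refine hBt ?_
    have e1 : (Fin.castSucc (⟨c, by omega⟩ : Fin (L + 1)) : Fin (L + 1 + 1)) = ⟨c, by omega⟩ := Fin.ext (by simp)
    have e2 : (Fin.succ (⟨c, by omega⟩ : Fin (L + 1)) : Fin (L + 1 + 1)) = ⟨c + 1, by omega⟩ := Fin.ext (by simp)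
    rw [e1, e2]
    exact (mul_eq_zero.1 this).resolve_left hβ
  -- `U = H_a ⊓ ker ℓ` by dimension, and the witness `W(a, −α/β)` lies in it
  set K : Submodule ℂ (Matrix (Fin (L + 1 + 1)) (Fin (L + 1 + 1)) ℂ) :=
    (nt ℂ (L + 1 + 1) ⊓ LinearMap.ker (Matrix.entryLinearMap ℂ ℂ (Fin.castSucc a) (Fin.succ a))) ⊓ LinearMap.ker ℓ with hK
  have hUK : U ≤ K := fun A hA => Submodule.mem_inf.2 ⟨hUH hA, LinearMap.mem_ker.2 (hℓU A hA)⟩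
  have hKlt : K < nt ℂ (L + 1 + 1) ⊓ LinearMap.ker (Matrix.entryLinearMap ℂ ℂ (Fin.castSucc a) (Fin.succ a)) := by
    refine lt_of_le_of_ne inf_le_left fun hEq => ?_
    -- `E_{c,c+1} ∈ H_a` has `ℓ = β ≠ 0`
    set E : Matrix (Fin (L + 1 + 1)) (Fin (L + 1 + 1)) ℂ := Matrix.of fun r s => if (r : ℕ) = c ∧ (s : ℕ) = c + 1 then (1 : ℂ) else 0 with hE
    have hEH : E ∈ nt ℂ (L + 1 + 1) ⊓ LinearMap.ker (Matrix.entryLinearMap ℂ ℂ (Fin.castSucc a) (Fin.succ a)) := by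
      rw [mem_nt_inf_ker_entry]
      refine ⟨fun i j hij => ?_, ?_⟩
      · have hij' : (j : ℕ) ≤ i := hij
        rw [hE, Matrix.of_apply, if_neg (by omega)]
      · rw [hE, Matrix.of_apply, if_neg (by simp; omega)]
    rw [← hEq, hK, Submodule.mem_inf, LinearMap.mem_ker, hℓap, hE, Matrix.of_apply, Matrix.of_apply, if_pos ⟨rfl, rfl⟩,
      if_neg (by simp)] at hEH
    exact hβ (by simpa using hEH.2)
  have hUeq : U = K := Submodule.eq_of_le_of_finrank_le hUK (by
    have h1 := Submodule.finrank_lt_finrank_of_lt hKlt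
    rw [finrank_nt_inf_ker_entry] at h1
    omega)
  set W : Matrix (Fin (L + 1 + 1)) (Fin (L + 1 + 1)) ℂ := Matrix.of fun r s : Fin (L + 1 + 1) =>
      if (s : ℕ) = r + 1 ∧ (r : ℕ) + 1 ≠ (a : ℕ) ∧ (r : ℕ) ≠ (a : ℕ) then (1 : ℂ)
      else if (r : ℕ) + 1 = (a : ℕ) ∧ (s : ℕ) = (a : ℕ) + 1 then 1
      else if (r : ℕ) + 1 = (a : ℕ) ∧ (s : ℕ) = (a : ℕ) then (-α / β : ℂ) else 0 with hW
  have hWU : W ∈ U := by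
    rw [hUeq, hK, Submodule.mem_inf, mem_nt_inf_ker_entry, LinearMap.mem_ker, hℓap]
    refine ⟨⟨skipChain_isStrictUpper L a _, skipChain_superdiag_self L a _ a rfl⟩, ?_⟩
    have h1 := skipChain_superdiag_pred L a (-α / β) ⟨c, by omega⟩ (by simp; omega)
    have h2 := skipChain_superdiag_of_ne L a (-α / β) ⟨c + 2, by omega⟩ (by simp; omega) (by simp; omega)
    have e1 : (Fin.castSucc (⟨c, by omega⟩ : Fin (L + 1)) : Fin (L + 1 + 1)) = ⟨c, by omega⟩ := Fin.ext (by simp)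
    have e2 : (Fin.succ (⟨c, by omega⟩ : Fin (L + 1)) : Fin (L + 1 + 1)) = ⟨c + 1, by omega⟩ := Fin.ext (by simp)
    have e3 : (Fin.castSucc (⟨c + 2, by omega⟩ : Fin (L + 1)) : Fin (L + 1 + 1)) = ⟨c + 2, by omega⟩ := Fin.ext (by simp)
    have e4 : (Fin.succ (⟨c + 2, by omega⟩ : Fin (L + 1)) : Fin (L + 1 + 1)) = ⟨c + 3, by omega⟩ := Fin.ext (by simp)
    rw [e1, e2] at h1
    rw [e3, e4] at h2
    rw [hW, h1, h2]
    field_simp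
    ring
  exact skipChain_pow_ne_zero L a _ (hpow W hWU)

end Main

/-! ## The conjugation-invariant form -/

/-- **LEMMA T2 for a triangularisable codimension-two space.**  If `V ≤ M_{L+2}(ℂ)` is conjugate into `𝔫` (`P V P⁻¹ ⊆ 𝔫`), `dim V = C(L+2,2) − 2` and
`A ^ L = 0` on `V`, then `P V P⁻¹` is the coordinate pattern `𝔫 ∖ {E_{a,a+1}, E_{b,b+1}}` with `a + 2 ≤ b`.  This is the triangularisable
half of PREREG Q22's conjecture C2; the non-triangularisable half is the (open) deficiency-two classification. [this file] -/
theorem codimTwo_pattern_of_triangularisable {L : ℕ} (V : Submodule ℂ (Matrix (Fin (L + 1 + 1)) (Fin (L + 1 + 1)) ℂ))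
    (P : Matrix (Fin (L + 1 + 1)) (Fin (L + 1 + 1)) ℂ) (hP : IsUnit P) (hPV : ∀ A ∈ V, IsStrictUpper (P * A * P⁻¹))
    (hdim : Module.finrank ℂ V = (L + 1 + 1).choose 2 - 2) (hpow : ∀ A ∈ V, A ^ L = 0) :
    ∃ a b : Fin (L + 1), (a : ℕ) + 2 ≤ b ∧
      ∀ A, A ∈ V ↔ IsStrictUpper (P * A * P⁻¹) ∧ (P * A * P⁻¹) a.castSucc a.succ = 0 ∧ (P * A * P⁻¹) b.castSucc b.succ = 0 := by
  classical
  have hPdet : IsUnit P.det := (Matrix.isUnit_iff_isUnit_det P).1 hP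
  set U : Submodule ℂ (Matrix (Fin (L + 1 + 1)) (Fin (L + 1 + 1)) ℂ) :=
    V.map (conjEquiv P hPdet : Matrix (Fin (L + 1 + 1)) (Fin (L + 1 + 1)) ℂ →ₗ[ℂ] Matrix (Fin (L + 1 + 1)) (Fin (L + 1 + 1)) ℂ) with hUdef
  have hφ : ∀ A, conjEquiv P hPdet A = P * A * P⁻¹ := fun A => rfl
  have hmemU : ∀ A, A ∈ V ↔ P * A * P⁻¹ ∈ U := fun A => by
    rw [← hφ, hUdef, Submodule.mem_map_equiv, LinearEquiv.symm_apply_apply]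
  have hUsu : ∀ B ∈ U, IsStrictUpper B := by
    rintro B ⟨A, hA, rfl⟩; exact hPV A hA
  have hUdim : Module.finrank ℂ U = (L + 1 + 1).choose 2 - 2 := by rw [hUdef, LinearEquiv.finrank_map_eq]; exact hdim
  have hUpow : ∀ B ∈ U, B ^ L = 0 := by
    rintro B ⟨A, hA, rfl⟩
    show (conjEquiv P hPdet A) ^ L = 0
    rw [hφ, conj_pow P hPdet, hpow A hA, Matrix.mul_zero, Matrix.zero_mul]
  obtain ⟨a, b, hab, hmem⟩ := strictUpper_codimTwo_of_pow_eq_zero U hUsu hUdim hUpow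
  exact ⟨a, b, hab, fun A => by rw [hmemU, hmem]⟩

end Summit.ValiantsHypothesis.ValiantsHypothesis.Theorems.GrenetZeon.HeavyTopNilIndexCodimTwo

end
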